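/-
Origin: expansion seat `prover-pub-hodgecm-mc-sinst-1-g11-0`, handover #1257 2026-08-21T01:42Z md5 7f110da73ea5 (433 l.; NEW additive DROP-ALONE leaf, ns HodgeCM.Model.ThetaDistFin, slot 2 (§§1–2) + slot 3 (§§3–4) verbatim the #1249 statements with Two/Three data: abbrev UfTwo/UfThree (U(⟨a₂⟩)(𝔸_f), U(⟨a₃⟩)(𝔸_f), a₂ = dW' S 0, a₃ = dW' S 1), def finPairDTwo/Three (+ _apply rfl), def finCharTwo/Three := (η₂/η₃ ∘ (finAdelicToAdelic ∘ finFrameCongr) × finLineTorus) · (cmConjLineChar₀/₁ … (dW S) … (dW' S) … S.isoGL (isoGL_hg₀ S) hGR hGR₂ hGR₃ ∘ finPairD…) (+ _apply rfl), def finRepTwo/Three := congr (finSBReindex e₁) (twist finChar… (finPairRep (splittingOf_isCompatible … hGR₂/hGR₃) ∘ (finFrameCongr × id))) (+ _apply), cmPairRep_finPairTwo/Three_tmul, cmConjLineRepFin₀_finPairTwo_tmul / cmConjLineRepFin₁_finPairThree_tmul, lineRepOf_two/three_finToG_eq_adelicTensorEnd (fin_V; carch lineRepOf_two/three_regime_finAdelicG),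 lineRepOf_two/three_one_finLineTorusIdeles_eq_adelicTensorEnd (fin_W; carch lineRepOf_two/three_one_finLineTorus + torusScalar_two/three_applyG + cmCenter_finLineTorus), finRepTwo_smooth (hη₂c, h₁W, Φ₀ ≠ 0; tree …cmConjLineRepFin₀_thinCosetTestFunₗ_eq_self with the three majorants as in carch exists_deepFix_twoG) / finRepThree_smooth (hη₃c, Φ₀ ≠ 0; no sign hypothesis, tree …cmConjLineRepFin₁_thinCosetTestFunₗ_eq_self); NAMES for audit: HodgeCM.Model.ThetaDistFin.lineRepOf_two_finToG_eq_adelicTensorEnd · HodgeCM.Model.ThetaDistFin.finRepTwo_smooth · HodgeCM.Model.ThetaDistFin.finRepThree_smooth) (`HOME/mc/pub-hodgecm-mc-sinst-1-g11/stage69/HodgeCM/Model/AdelicThetaDistributionFin34.lean`, md5 7f110da73ea5, 433 lines);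
landed by the gen-29 packager (p-g29) in gate run 69 as `HodgeCM/Model/AdelicThetaDistributionFin34.lean` (verbatim).
-/
/-
Copyright (c) 2026 the pub-hodgecm formalisation cell (harness21).  New file, not vendored.
Origin: session prover-pub-hodgecm-mc-sinst-1-g11-0 (unit pub-hodgecm-mc-sinst-1-g11, S-INSTANCE CONSTRUCTOR gen 11; the FINITE half of the honest
(J4) product Weil datum at the CONJUGATED-PLANE slots: the finite factor of the line representations `lineRepOf … k`, k = 2, 3, as operators
`1 ⊗ ω_f` — the slot-2 ∕ slot-3 clone of #1249 `Model/AdelicThetaDistributionFin`, asked for by binder-1 (STATUS l.14897, SLOTS 2 AND 3) and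
model1 (l.14898 (5): E consumes `hΘ` at all four slots)), 2026-08-21.
Intended final place: `HodgeCM/Model/AdelicThetaDistributionFin34.lean` (NEW additive model-layer leaf; imports sinst-1 #1249
`Model/AdelicThetaDistributionFin` (slots 0 ∕ 1: shared helpers `schwartzReindexCLM_apply_symm_apply`, `tmul_left_cancel_fin`) and carch #CA27
`Model/ArchKTypeOfFinChar34` (`lineRepOf_two∕three_regime_finAdelicG`, the vendored `…SeesawCMLinesConjDeepLevelFixed`); nothing imports it;
drop alone).
-/
import Summits.HodgeConjecture.HodgeCM.Model.AdelicThetaDistributionFin_2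
import Summits.HodgeConjecture.HodgeCM.Model.ArchKTypeOfFinChar34

set_option autoImplicit false

/-!
# The finite factor of the line representations at the conjugated-plane slots: `lineRepOf k`, `k = 2, 3`, at finite points is `1 ⊗ ω_{f,k}`

For the character-generic S-side line representation `lineRepOf V S hGR hGR₀ hGR₁ hGR₂ hGR₃ η₀ η₁ η₂ η₃ k` (period-1 LAYER B; at
`archSideOf` it is `(P k).ω` by `archSideOf_P_ω`), k = 2 (§§ 1–2, `Two` names) and, with the same proofs, k = 3 (§§ 3–4, `Three` names) —
the lines `⟨a₂⟩`, `⟨a₃⟩` (`a₂ = dW' S 0`, `a₃ = dW' S 1`) of the CONJUGATED plane `isoGL · diag(a₂, a₃) · isoGL⁻¹` (tree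
`cmConjLineRepFin₀ ∕ ₁`, compatible splittings `splittingOf hGR₂ ∕ hGR₃`):
* `finRepTwo … : Representation ℂ (U(V)(𝔸_f) × U(W₂)(𝔸_f)) 𝒮((𝔸_{L⁺}^∞)³)` — THE FINITE FACTOR: theta-3's `WeilCoinv.finPairRep` of the small
  pair `(U(diag frameD V), U(⟨a₂⟩))` at the compatible splitting `splittingOf hGR₂` ([GelbartRogawski1991, Prop. 3.1.1]), read on `Fin 3`
  through `finSBReindex e₁`, pulled back along carch's frame transport `finFrameCongr` on the `U(V)`-member, and TWISTED by the scalar see-saw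
  character `finCharTwo = (η₂ · χ₂′)` of the slot (tree `cmConjLineRepFin₀_apply_eq_smul_cmPairRep`);
* **`lineRepOf_two_finToG_eq_adelicTensorEnd`**: `lineRepOf … 2 (finToG V hV g, 1) = 1 ⊗ finRepTwo (g, 1)` — the field `fin_V` of
  `ThetaAdelicSide.ThetaDistDatum` (#1246) at the honest side (carch #CA27 `lineRepOf_two_regime_finAdelicG` → tree Collapse → theta-3
  `pairRep_finPairToAdelic_piSBReindex_tmul`);
* **`lineRepOf_two_one_finLineTorusIdeles_eq_adelicTensorEnd`**: `lineRepOf … 2 (1, finLineTorusIdeles u_f) = 1 ⊗ finRepTwo (1, u_f)` — the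
  field `fin_W` (carch #CA60 `lineRepOf_two_one_finLineTorus`);
* **`finRepTwo_smooth`**: every `Φ_f` is fixed under `finRepTwo (·, 1)` by an OPEN subgroup of `U(V)(𝔸_f)` — the field `smooth` (tree
  `…cmConjLineRepFin₀_thinCosetTestFunₗ_eq_self` on the coset decomposition of `Φ_f`, read back on the finite factor through a nonzero `Φ_∞`);
* §§ 3–4: the same four for slot 3 (`finRepThree`, `lineRepOf_three_finToG_eq_adelicTensorEnd`,
  `lineRepOf_three_one_finLineTorusIdeles_eq_adelicTensorEnd`, `finRepThree_smooth` — no sign hypothesis, as in the tree's line-3 theorem).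
KERNEL only: 0 records, 0 `def … : Prop`, nothing cited as a sentence; `#print axioms` ⊆ {propext, Classical.choice, Quot.sound}.
-/

noncomputable section

open NumberField NumberField.mixedEmbedding IsDedekindDomain
open scoped Matrix TensorProduct Classical SchwartzMap
open Literature.NumberTheory.Automorphic Literature.NumberTheory.Weil1964
open Literature.NumberTheory.GelbartRogawski1991 Literature.NumberTheory.GelbartRogawski1991.UnitaryDualPair
open Literature.RepresentationTheory (SeesawScalar.twist SeesawScalar.twist_apply)
open HodgeCM.Adelic HodgeCM.PerL34 HodgeCM.Model.ArchSideTerm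

namespace HodgeCM.Model
namespace ThetaDistFin

variable {L : CMField} {ι₁ : L →+* ℂ} (V : HermSpace3 L ι₁) (S : StubTree.SeesawDatum L)
variable
  (hGR : (cmSplittingDatum (L : Type) finProdFinEquiv (frameD V) (frameD_real V) (frameD_ne V) (dW S) (dW_real S) (dW_ne S)).CompatibleSplitting)
  (hGR₀ : (cmSplittingDatum (L : Type) (e₁) (frameD V) (frameD_real V) (frameD_ne V) (lineVec (L : Type) (dW S 0))
    (fun _ => dW_real S 0) (fun _ => dW_ne S 0)).CompatibleSplitting)
  (hGR₁ : (cmSplittingDatum (L : Type) (e₁) (frameD V) (frameD_real V) (frameD_ne V) (lineVec (L : Type) (dW S 1))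
    (fun _ => dW_real S 1) (fun _ => dW_ne S 1)).CompatibleSplitting)
  (hGR₂ : (cmSplittingDatum (L : Type) (e₁) (frameD V) (frameD_real V) (frameD_ne V) (lineVec (L : Type) (dW' S 0))
    (fun _ => dW'_real S 0) (fun _ => dW'_ne S 0)).CompatibleSplitting)
  (hGR₃ : (cmSplittingDatum (L : Type) (e₁) (frameD V) (frameD_real V) (frameD_ne V) (lineVec (L : Type) (dW' S 1))
    (fun _ => dW'_real S 1) (fun _ => dW'_ne S 1)).CompatibleSplitting)
  (η₀ η₁ η₂ η₃ : CMAdelic (L : Type) (frameD V) × CMAdelicOne (L : Type) →* ℂˣ)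
  (hV : IsAnisotropic L V.Hm)

/-! ### § 1. The finite factor of slot 2 -/

/-- the finite `U(W₂)(𝔸_f)` of the framed line `⟨a₂⟩`, `a₂ = dW' S 0`. -/
abbrev UfTwo : Type :=
  ↥(UnitaryGroup.finAdelic (↥(maximalRealSubfield L)) (L : Type) (IsCMField.complexConj L) 1
    (Matrix.diagonal (lineVec (L : Type) (dW' S 0))))

/-- the framed finite pair element of `(g, u_f)`: `((1, finFrameCongr g), (1, u_f))` in `U(diag frameD V)(𝔸) × U(⟨a₂⟩)(𝔸)`. -/
def finPairDTwo : ↥V.adelicFin × UfTwo S →*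
    CMAdelic (L : Type) (frameD V) × CMAdelic (L : Type) (lineVec (L : Type) (dW' S 0)) :=
  (UnitaryGroup.finAdelicToAdelic (↥(maximalRealSubfield L)) (L : Type) (IsCMField.complexConj L) 3 (Matrix.diagonal (frameD V))).prodMap
      (UnitaryGroup.finAdelicToAdelic (↥(maximalRealSubfield L)) (L : Type) (IsCMField.complexConj L) 1
        (Matrix.diagonal (lineVec (L : Type) (dW' S 0)))) |>.comp
    ((finFrameCongr (L : Type) V.Hm (frameG V) (frameD V) (frame_congr V)).prodMap (MonoidHom.id _))

/-- (Ported verbatim from the HodgeCMPerL package; no docstring in the source.) -/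
@[simp] theorem finPairDTwo_apply (g : ↥V.adelicFin) (u : UfTwo S) :
    finPairDTwo V S (g, u) =
      (UnitaryGroup.finAdelicToAdelic (↥(maximalRealSubfield L)) (L : Type) (IsCMField.complexConj L) 3 (Matrix.diagonal (frameD V))
          (finFrameCongr (L : Type) V.Hm (frameG V) (frameD V) (frame_congr V) g),
        UnitaryGroup.finAdelicToAdelic (↥(maximalRealSubfield L)) (L : Type) (IsCMField.complexConj L) 1
          (Matrix.diagonal (lineVec (L : Type) (dW' S 0))) u) := rfl

/-- **the scalar see-saw character of slot 2 on the finite pair**: `(g, u_f) ↦ η₂(v, t) · χ₀(v, t)` at `v = (1, finFrameCongr g)`,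
`t = finLineTorus u_f` (tree `cmConjLineRepFin₀_apply_eq_smul_cmPairRep`, carch `cmCenter_finLineTorus`). -/
def finCharTwo : ↥V.adelicFin × UfTwo S →* ℂˣ :=
  (η₂.comp
      (((UnitaryGroup.finAdelicToAdelic (↥(maximalRealSubfield L)) (L : Type) (IsCMField.complexConj L) 3
            (Matrix.diagonal (frameD V))).comp (finFrameCongr (L : Type) V.Hm (frameG V) (frameD V) (frame_congr V))).prodMap
        (finLineTorus (L : Type) (dW' S 0) (dW'_ne S 0)))) *
    (cmConjLineChar₀ (L : Type) finProdFinEquiv e₁ (frameD V) (frameD_real V) (frameD_ne V) (dW S) (dW_real S) (dW_ne S) (dW' S) (dW'_real S)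
        (dW'_ne S) S.isoGL (isoGL_hg₀ S) hGR hGR₂ hGR₃).comp
      (finPairDTwo V S)

/-- (Ported verbatim from the HodgeCMPerL package; no docstring in the source.) -/
@[simp] theorem finCharTwo_apply (g : ↥V.adelicFin) (u : UfTwo S) :
    finCharTwo V S hGR hGR₂ hGR₃ η₂ (g, u) =
      η₂ (UnitaryGroup.finAdelicToAdelic (↥(maximalRealSubfield L)) (L : Type) (IsCMField.complexConj L) 3 (Matrix.diagonal (frameD V))
            (finFrameCongr (L : Type) V.Hm (frameG V) (frameD V) (frame_congr V) g), finLineTorus (L : Type) (dW' S 0) (dW'_ne S 0) u) *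
        cmConjLineChar₀ (L : Type) finProdFinEquiv e₁ (frameD V) (frameD_real V) (frameD_ne V) (dW S) (dW_real S) (dW_ne S) (dW' S) (dW'_real S)
        (dW'_ne S) S.isoGL (isoGL_hg₀ S) hGR hGR₂ hGR₃
          (finPairDTwo V S (g, u)) := rfl

/-- **THE FINITE FACTOR of slot 2**: `finCharTwo • (R_{e₁}^f ∘ finPairRep (splittingOf hGR₂) (finFrameCongr g, u_f) ∘ (R_{e₁}^f)⁻¹)` on
`𝒮((𝔸_{L⁺}^∞)³)`. -/
def finRepTwo : Representation ℂ (↥V.adelicFin × UfTwo S) (FinSB (↥(maximalRealSubfield L)) (Fin 3)) :=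
  Representation.congr (finSBReindex (↥(maximalRealSubfield L)) e₁)
    (SeesawScalar.twist (finCharTwo V S hGR hGR₂ hGR₃ η₂)
      ((HodgeCM.WeilCoinv.finPairRep _ _ _ _ _ _ _ _ _ _ _ _ _ _ _ _ _
          (splittingOf_isCompatible _ _ _ _ _ _ _ _ _ _ _ _ _ _ _ _ _ hGR₂)).comp
        ((finFrameCongr (L : Type) V.Hm (frameG V) (frameD V) (frame_congr V)).prodMap (MonoidHom.id (UfTwo S)))))


/-- `finRepTwo (g, u) Φ_f = finCharTwo (g, u) • R_{e₁}^f (finPairRep (finFrameCongr g, u) ((R_{e₁}^f)⁻¹ Φ_f))`. -/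
theorem finRepTwo_apply (g : ↥V.adelicFin) (u : UfTwo S) (Φf : FinSB (↥(maximalRealSubfield L)) (Fin 3)) :
    finRepTwo V S hGR hGR₂ hGR₃ η₂ (g, u) Φf =
      ((finCharTwo V S hGR hGR₂ hGR₃ η₂ (g, u) : ℂˣ) : ℂ) •
        finSBReindex (↥(maximalRealSubfield L)) e₁
          (HodgeCM.WeilCoinv.finPairRep _ _ _ _ _ _ _ _ _ _ _ _ _ _ _ _ _
              (splittingOf_isCompatible _ _ _ _ _ _ _ _ _ _ _ _ _ _ _ _ _ hGR₂)
              (finFrameCongr (L : Type) V.Hm (frameG V) (frameD V) (frame_congr V) g, u)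
            ((finSBReindex (↥(maximalRealSubfield L)) e₁).symm Φf)) := by
  conv_lhs => rw [← (finSBReindex (↥(maximalRealSubfield L)) e₁).apply_symm_apply Φf]
  rw [finRepTwo, Representation.congr_apply_apply, SeesawScalar.twist_apply, map_smul]
  rfl

/-- **The small pair's Weil representation at a finite pair point, on `𝒮(𝔸³)`, is `1 ⊗ (R^f ∘ finPairRep ∘ (R^f)⁻¹)`** (theta-3 #S14r2
`pairRep_finPairToAdelic_piSBReindex_tmul` transported through the reindexing `e₁ : Fin 3 × Fin 1 ≃ Fin 3`). -/
theorem cmPairRep_finPairTwo_tmul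
    (p : ↥(UnitaryGroup.finAdelic (↥(maximalRealSubfield L)) (L : Type) (IsCMField.complexConj L) 3 (Matrix.diagonal (frameD V))) × UfTwo S)
    (Φinf : 𝓢((Fin 3 → mixedSpace (↥(maximalRealSubfield L))), ℂ)) (Φf : FinSB (↥(maximalRealSubfield L)) (Fin 3)) :
    cmPairRep (L : Type) e₁ (frameD V) (frameD_real V) (frameD_ne V) (lineVec (L : Type) (dW' S 0)) (fun _ => dW'_real S 0) (fun _ => dW'_ne S 0)
        hGR₂ (HodgeCM.WeilCoinv.finPairToAdelic _ _ _ _ _ _ _ p)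
        (piSchwartzBruhatEquiv (↥(maximalRealSubfield L)) (Fin 3) (Φinf ⊗ₜ[ℂ] Φf)) =
      piSchwartzBruhatEquiv (↥(maximalRealSubfield L)) (Fin 3)
        (Φinf ⊗ₜ[ℂ] finSBReindex (↥(maximalRealSubfield L)) e₁
          (HodgeCM.WeilCoinv.finPairRep _ _ _ _ _ _ _ _ _ _ _ _ _ _ _ _ _
              (splittingOf_isCompatible _ _ _ _ _ _ _ _ _ _ _ _ _ _ _ _ _ hGR₂) p
            ((finSBReindex (↥(maximalRealSubfield L)) e₁).symm Φf))) := by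
  have key := HodgeCM.WeilCoinv.pairRep_finPairToAdelic_piSBReindex_tmul _ _ _ _ _ _ _ _ _ _ _ _ _ _ _ _ _
    (splittingOf_isCompatible _ _ _ _ _ _ _ _ _ _ _ _ _ _ _ _ _ hGR₂) p
    (schwartzReindexCLM (↥(maximalRealSubfield L)) e₁.symm Φinf) ((finSBReindex (↥(maximalRealSubfield L)) e₁).symm Φf)
  rw [piSBReindex_tmul, piSBReindex_tmul, schwartzReindexCLM_apply_symm_apply, LinearEquiv.apply_symm_apply] at key
  exact key

omit hV in
/-- **the twisted line representation at a framed finite `U(V)`-element, on pure tensors**: `ω₀″((1,k_f),1) (Φ_∞ ⊗ Φ_f) = Φ_∞ ⊗ finRepTwo (g,1) Φ_f`,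
`k_f = finFrameCongr g` (tree Collapse + theta-3 #S14r2). -/
theorem cmConjLineRepFin₀_finPairTwo_tmul (g : ↥V.adelicFin) (Φinf : 𝓢((Fin 3 → mixedSpace (↥(maximalRealSubfield L))), ℂ))
    (Φf : FinSB (↥(maximalRealSubfield L)) (Fin 3)) :
    cmConjLineRepFin₀ (L : Type) finProdFinEquiv e₁ (frameD V) (frameD_real V) (frameD_ne V) (dW S) (dW_real S) (dW_ne S) (dW' S) (dW'_real S)
        (dW'_ne S) S.isoGL (isoGL_hg₀ S) hGR hGR₂ hGR₃ η₂
        (UnitaryGroup.finAdelicToAdelic (↥(maximalRealSubfield L)) (L : Type) (IsCMField.complexConj L) 3 (Matrix.diagonal (frameD V))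
          (finFrameCongr (L : Type) V.Hm (frameG V) (frameD V) (frame_congr V) g), 1)
        (piSchwartzBruhatEquiv (↥(maximalRealSubfield L)) (Fin 3) (Φinf ⊗ₜ[ℂ] Φf)) =
      piSchwartzBruhatEquiv (↥(maximalRealSubfield L)) (Fin 3) (Φinf ⊗ₜ[ℂ] finRepTwo V S hGR hGR₂ hGR₃ η₂ (g, 1) Φf) := by
  rw [cmConjLineRepFin₀_apply_eq_smul_cmPairRep, map_one, map_one, finRepTwo_apply, TensorProduct.tmul_smul, map_smul]
  congr 1
  · -- the scalars
    rw [finCharTwo_apply, finPairDTwo_apply, map_one, map_one]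
    rfl
  · -- the operators
    have h := cmPairRep_finPairTwo_tmul V S hGR₂ (finFrameCongr (L : Type) V.Hm (frameG V) (frameD V) (frame_congr V) g, 1) Φinf Φf
    simp only [HodgeCM.WeilCoinv.finPairToAdelic_apply, map_one] at h
    exact h

/-- **`fin_V` for slot 2**: `lineRepOf … 0 (finToG V hV g, 1) = 1 ⊗ finRepTwo (g, 1)` as operators on `𝒮(𝔸_{L⁺}³)`. -/
theorem lineRepOf_two_finToG_eq_adelicTensorEnd (g : ↥V.adelicFin) :
    lineRepOf V S hGR hGR₀ hGR₁ hGR₂ hGR₃ η₀ η₁ η₂ η₃ 2 (finToG V hV g, 1) =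
      adelicTensorEnd (K := ↥(maximalRealSubfield L)) (ι := Fin 3) LinearMap.id (finRepTwo V S hGR hGR₂ hGR₃ η₂ (g, 1)) := by
  apply linearMap_ext_tensor
  intro Φinf Φf
  rw [adelicTensorEnd_apply_tmul, LinearMap.id_apply, finToG_apply, cmAdelicProdEquiv_symm_one,
    lineRepOf_two_regime_finAdelicG V S hGR hGR₀ hGR₁ hGR₂ hGR₃ η₀ η₁ η₂ η₃ hV g, cmConjLineRepFin₀_finPairTwo_tmul]

/-- **`fin_W` for slot 2**: `lineRepOf … 0 (1, finLineTorusIdeles u_f) = 1 ⊗ finRepTwo (1, u_f)` as operators on `𝒮(𝔸_{L⁺}³)` (carch #CA60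
`lineRepOf_two_one_finLineTorus` + theta-3 #S14r2 at the pair point `(1, u_f)`). -/
theorem lineRepOf_two_one_finLineTorusIdeles_eq_adelicTensorEnd (uf : UfTwo S) :
    lineRepOf V S hGR hGR₀ hGR₁ hGR₂ hGR₃ η₀ η₁ η₂ η₃ 2 (1, finLineTorusIdeles (L : Type) (dW' S 0) (dW'_ne S 0) uf) =
      adelicTensorEnd (K := ↥(maximalRealSubfield L)) (ι := Fin 3) LinearMap.id (finRepTwo V S hGR hGR₂ hGR₃ η₂ (1, uf)) := by
  apply linearMap_ext_tensor
  intro Φinf Φf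
  rw [adelicTensorEnd_apply_tmul, LinearMap.id_apply, lineRepOf_two_one_finLineTorus, finRepTwo_apply, TensorProduct.tmul_smul, map_smul]
  congr 1
  · -- the scalars
    rw [torusScalar_two_applyG, finCharTwo_apply, finPairDTwo_apply, map_one, map_one, cmCenter_finLineTorus]
    rfl
  · -- the operators
    have h := cmPairRep_finPairTwo_tmul V S hGR₂ (1, uf) Φinf Φf
    simp only [HodgeCM.WeilCoinv.finPairToAdelic_apply, map_one] at h
    rw [map_one]
    exact h

/-! ### § 2. Smoothness of the finite factor -/

/-- **smoothness of the finite factor of slot 2**: every finite test function is fixed under `finRepTwo (·, 1)` by an OPEN subgroup of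
`U(V)(𝔸_f)` — the pull-back along `finFrameCongr` of a deep principal congruence level (tree `…cmLineRepFin₀_thinCosetTestFunₗ_eq_self`
[GelbartRogawski1991 §3.1 Remark p. 457; Weil1964 n° 41 Thm 6] through the coset decomposition `exists_eq_sum_smul_finTranslateSB_indicatorSB` of
`Φ_f`, read back on the finite factor by `fin_V` and a nonzero archimedean vector `Φ₀`). -/
theorem finRepTwo_smooth (hη₂c : Continuous fun p => ((η₂ p : ℂˣ) : ℂ))
    (h₁W : (∀ j, 0 < (ι₁ (dW S j)).re) ∨ ∀ j, (ι₁ (dW S j)).re < 0)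
    {Φ₀ : 𝓢((Fin 3 → mixedSpace (↥(maximalRealSubfield L))), ℂ)} (hΦ₀ : Φ₀ ≠ 0) (Φf : FinSB (↥(maximalRealSubfield L)) (Fin 3)) :
    ∃ K : Subgroup ↥V.adelicFin, IsOpen (K : Set ↥V.adelicFin) ∧ ∀ g ∈ K, finRepTwo V S hGR hGR₂ hGR₃ η₂ (g, 1) Φf = Φf := by
  -- a level of `Φf` and its coset decomposition
  obtain ⟨𝔫, -, hlev⟩ := exists_level_of_mem_schwartzBruhat (↥(maximalRealSubfield L)) Φf.2
  obtain ⟨s, hs⟩ := exists_eq_sum_smul_finTranslateSB_indicatorSB (piLevelIdeal (↥(maximalRealSubfield L)) (Fin 3) 𝔫)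
    (isOpen_piLevelIdeal (↥(maximalRealSubfield L)) 𝔫) (isCompact_piLevelIdeal (↥(maximalRealSubfield L)) (Fin 3) 𝔫) Φf hlev
  -- one deep level fixing every coset test function `Φ_∞ ⊗ 𝟙_{q + 𝔫𝒪̂³}`, `q ∈ s`
  obtain ⟨n₀, hn₀, hfix⟩ :=
    exists_nat_forall_dvd_finCongruenceLevel_forall_cmConjLineRepFin₀_thinCosetTestFunₗ_eq_self (L : Type) finProdFinEquiv e₁
      (frameD V) (frameD_real V) (frameD_ne V) (dW S) (dW_real S) (dW_ne S) (dW' S) (dW'_real S) (dW'_ne S) S.isoGL (isoGL_hg₀ S)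
      hGR hGR₂ hGR₃ η₂
      (hasThetaMajorants_cmPairSplitting_of_signs_two (L : Type) finProdFinEquiv (frameD V) (frameD_real V) (frameD_ne V) (dW S)
        (dW_real S) (dW_ne S) ι₁ hGR (frameD_sign_ι₁' V) h₁W (frameD_sign_of_ne V))
      (hasThetaMajorants_omega_pairSmall₁_lineVec_of_signs (L : Type) e₁ (frameD V) (frameD_real V) (frameD_ne V) (dW' S 0)
        (dW'_real S 0) (dW'_ne S 0) hGR₂ ι₁ (frameD_sign_ι₁' V) (frameD_sign_of_ne V))
      (hasThetaMajorants_omega_pairSmall₂_lineVec_of_signs (L : Type) e₁ (frameD V) (frameD_real V) (frameD_ne V) (dW' S 1)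
        (dW'_real S 1) (dW'_ne S 1) hGR₃ ι₁ (frameD_sign_ι₁' V) (frameD_sign_of_ne V))
      hη₂c (A := ↥s) (fun q => (q.1.out : Fin 3 → FiniteAdeleRing (𝓞 ↥(maximalRealSubfield L)) ↥(maximalRealSubfield L)))
      (fun _ => 𝔫)
  have hlvl : Ideal.span {((n₀ : ℕ) : 𝓞 (L : Type))} ≠ 0 := span_natCast_ne_zero (L := L) hn₀
  refine ⟨(UnitaryGroup.finCongruenceLevel (↥(maximalRealSubfield L)) (L : Type) (IsCMField.complexConj L) 3 (Matrix.diagonal (frameD V))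
      (Ideal.span {((n₀ : ℕ) : 𝓞 (L : Type))})).comap (finFrameCongr (L : Type) V.Hm (frameG V) (frameD V) (frame_congr V)), ?_, ?_⟩
  · rw [Subgroup.coe_comap]
    exact (UnitaryGroup.isOpen_finCongruenceLevel (F := ↥(maximalRealSubfield L)) (E := (L : Type)) (c := IsCMField.complexConj L)
      (N := 3) (J := Matrix.diagonal (frameD V)) hlvl).preimage (continuous_finFrameCongr (L : Type) V.Hm (frameG V) (frameD V) (frame_congr V))
  · intro g hg
    have hq : ∀ q ∈ s, finRepTwo V S hGR hGR₂ hGR₃ η₂ (g, 1)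
        (cosetIndicatorSB (↥(maximalRealSubfield L)) (Fin 3) (q.out : Fin 3 → FiniteAdeleRing (𝓞 ↥(maximalRealSubfield L)) _) 𝔫) =
        cosetIndicatorSB (↥(maximalRealSubfield L)) (Fin 3) (q.out : Fin 3 → FiniteAdeleRing (𝓞 ↥(maximalRealSubfield L)) _) 𝔫 := by
      intro q hqs
      have h := hfix n₀ hn₀ (dvd_refl _) _ (Subgroup.mem_comap.mp hg) ⟨q, hqs⟩ Φ₀
      rw [thinCosetTestFunₗ_eq_tmul_cosetIndicatorSB, cmConjLineRepFin₀_finPairTwo_tmul] at h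
      exact tmul_left_cancel_fin hΦ₀ ((piSchwartzBruhatEquiv (↥(maximalRealSubfield L)) (Fin 3)).injective h)
    have hs' : Φf = ∑ q ∈ s, ((Φf : (Fin 3 → FiniteAdeleRing (𝓞 ↥(maximalRealSubfield L)) ↥(maximalRealSubfield L)) → ℂ) q.out) •
        cosetIndicatorSB (↥(maximalRealSubfield L)) (Fin 3) (q.out : Fin 3 → FiniteAdeleRing (𝓞 ↥(maximalRealSubfield L)) _) 𝔫 := hs
    calc finRepTwo V S hGR hGR₂ hGR₃ η₂ (g, 1) Φf
        = finRepTwo V S hGR hGR₂ hGR₃ η₂ (g, 1)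
            (∑ q ∈ s, ((Φf : (Fin 3 → FiniteAdeleRing (𝓞 ↥(maximalRealSubfield L)) ↥(maximalRealSubfield L)) → ℂ) q.out) •
              cosetIndicatorSB (↥(maximalRealSubfield L)) (Fin 3) (q.out : Fin 3 → FiniteAdeleRing (𝓞 ↥(maximalRealSubfield L)) _) 𝔫) := by
          rw [← hs']
      _ = ∑ q ∈ s, ((Φf : (Fin 3 → FiniteAdeleRing (𝓞 ↥(maximalRealSubfield L)) ↥(maximalRealSubfield L)) → ℂ) q.out) •
              cosetIndicatorSB (↥(maximalRealSubfield L)) (Fin 3) (q.out : Fin 3 → FiniteAdeleRing (𝓞 ↥(maximalRealSubfield L)) _) 𝔫 := by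
          rw [map_sum]
          exact Finset.sum_congr rfl fun q hq' => by rw [map_smul, hq q hq']
      _ = Φf := hs'.symm

/-! ### § 3. The finite factor of slot 3 -/

/-- the finite `U(W₃)(𝔸_f)` of the framed line `⟨a₃⟩`, `a₃ = dW' S 1`. -/
abbrev UfThree : Type :=
  ↥(UnitaryGroup.finAdelic (↥(maximalRealSubfield L)) (L : Type) (IsCMField.complexConj L) 1
    (Matrix.diagonal (lineVec (L : Type) (dW' S 1))))

/-- the framed finite pair element of `(g, u_f)`: `((1, finFrameCongr g), (1, u_f))` in `U(diag frameD V)(𝔸) × U(⟨a₃⟩)(𝔸)`. -/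
def finPairDThree : ↥V.adelicFin × UfThree S →*
    CMAdelic (L : Type) (frameD V) × CMAdelic (L : Type) (lineVec (L : Type) (dW' S 1)) :=
  (UnitaryGroup.finAdelicToAdelic (↥(maximalRealSubfield L)) (L : Type) (IsCMField.complexConj L) 3 (Matrix.diagonal (frameD V))).prodMap
      (UnitaryGroup.finAdelicToAdelic (↥(maximalRealSubfield L)) (L : Type) (IsCMField.complexConj L) 1
        (Matrix.diagonal (lineVec (L : Type) (dW' S 1)))) |>.comp
    ((finFrameCongr (L : Type) V.Hm (frameG V) (frameD V) (frame_congr V)).prodMap (MonoidHom.id _))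

/-- (Ported verbatim from the HodgeCMPerL package; no docstring in the source.) -/
@[simp] theorem finPairDThree_apply (g : ↥V.adelicFin) (u : UfThree S) :
    finPairDThree V S (g, u) =
      (UnitaryGroup.finAdelicToAdelic (↥(maximalRealSubfield L)) (L : Type) (IsCMField.complexConj L) 3 (Matrix.diagonal (frameD V))
          (finFrameCongr (L : Type) V.Hm (frameG V) (frameD V) (frame_congr V) g),
        UnitaryGroup.finAdelicToAdelic (↥(maximalRealSubfield L)) (L : Type) (IsCMField.complexConj L) 1
          (Matrix.diagonal (lineVec (L : Type) (dW' S 1))) u) := rfl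

/-- **the scalar see-saw character of slot 3 on the finite pair**: `(g, u_f) ↦ η₀(v, t) · χ₀(v, t)` at `v = (1, finFrameCongr g)`,
`t = finLineTorus u_f` (tree `cmConjLineRepFin₁_apply_eq_smul_cmPairRep`, carch `cmCenter_finLineTorus`). -/
def finCharThree : ↥V.adelicFin × UfThree S →* ℂˣ :=
  (η₃.comp
      (((UnitaryGroup.finAdelicToAdelic (↥(maximalRealSubfield L)) (L : Type) (IsCMField.complexConj L) 3
            (Matrix.diagonal (frameD V))).comp (finFrameCongr (L : Type) V.Hm (frameG V) (frameD V) (frame_congr V))).prodMap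
        (finLineTorus (L : Type) (dW' S 1) (dW'_ne S 1)))) *
    (cmConjLineChar₁ (L : Type) finProdFinEquiv e₁ (frameD V) (frameD_real V) (frameD_ne V) (dW S) (dW_real S) (dW_ne S) (dW' S) (dW'_real S)
        (dW'_ne S) S.isoGL (isoGL_hg₀ S) hGR hGR₂ hGR₃).comp
      (finPairDThree V S)

/-- (Ported verbatim from the HodgeCMPerL package; no docstring in the source.) -/
@[simp] theorem finCharThree_apply (g : ↥V.adelicFin) (u : UfThree S) :
    finCharThree V S hGR hGR₂ hGR₃ η₃ (g, u) =
      η₃ (UnitaryGroup.finAdelicToAdelic (↥(maximalRealSubfield L)) (L : Type) (IsCMField.complexConj L) 3 (Matrix.diagonal (frameD V))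
            (finFrameCongr (L : Type) V.Hm (frameG V) (frameD V) (frame_congr V) g), finLineTorus (L : Type) (dW' S 1) (dW'_ne S 1) u) *
        cmConjLineChar₁ (L : Type) finProdFinEquiv e₁ (frameD V) (frameD_real V) (frameD_ne V) (dW S) (dW_real S) (dW_ne S) (dW' S) (dW'_real S)
        (dW'_ne S) S.isoGL (isoGL_hg₀ S) hGR hGR₂ hGR₃
          (finPairDThree V S (g, u)) := rfl

/-- **THE FINITE FACTOR of slot 3**: `finCharThree • (R_{e₁}^f ∘ finPairRep (splittingOf hGR₃) (finFrameCongr g, u_f) ∘ (R_{e₁}^f)⁻¹)` on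
`𝒮((𝔸_{L⁺}^∞)³)`. -/
def finRepThree : Representation ℂ (↥V.adelicFin × UfThree S) (FinSB (↥(maximalRealSubfield L)) (Fin 3)) :=
  Representation.congr (finSBReindex (↥(maximalRealSubfield L)) e₁)
    (SeesawScalar.twist (finCharThree V S hGR hGR₂ hGR₃ η₃)
      ((HodgeCM.WeilCoinv.finPairRep _ _ _ _ _ _ _ _ _ _ _ _ _ _ _ _ _
          (splittingOf_isCompatible _ _ _ _ _ _ _ _ _ _ _ _ _ _ _ _ _ hGR₃)).comp
        ((finFrameCongr (L : Type) V.Hm (frameG V) (frameD V) (frame_congr V)).prodMap (MonoidHom.id (UfThree S)))))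


/-- `finRepThree (g, u) Φ_f = finCharThree (g, u) • R_{e₁}^f (finPairRep (finFrameCongr g, u) ((R_{e₁}^f)⁻¹ Φ_f))`. -/
theorem finRepThree_apply (g : ↥V.adelicFin) (u : UfThree S) (Φf : FinSB (↥(maximalRealSubfield L)) (Fin 3)) :
    finRepThree V S hGR hGR₂ hGR₃ η₃ (g, u) Φf =
      ((finCharThree V S hGR hGR₂ hGR₃ η₃ (g, u) : ℂˣ) : ℂ) •
        finSBReindex (↥(maximalRealSubfield L)) e₁
          (HodgeCM.WeilCoinv.finPairRep _ _ _ _ _ _ _ _ _ _ _ _ _ _ _ _ _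
              (splittingOf_isCompatible _ _ _ _ _ _ _ _ _ _ _ _ _ _ _ _ _ hGR₃)
              (finFrameCongr (L : Type) V.Hm (frameG V) (frameD V) (frame_congr V) g, u)
            ((finSBReindex (↥(maximalRealSubfield L)) e₁).symm Φf)) := by
  conv_lhs => rw [← (finSBReindex (↥(maximalRealSubfield L)) e₁).apply_symm_apply Φf]
  rw [finRepThree, Representation.congr_apply_apply, SeesawScalar.twist_apply, map_smul]
  rfl

/-- **The small pair's Weil representation at a finite pair point, on `𝒮(𝔸³)`, is `1 ⊗ (R^f ∘ finPairRep ∘ (R^f)⁻¹)`** (theta-3 #S14r2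
`pairRep_finPairToAdelic_piSBReindex_tmul` transported through the reindexing `e₁ : Fin 3 × Fin 1 ≃ Fin 3`). -/
theorem cmPairRep_finPairThree_tmul
    (p : ↥(UnitaryGroup.finAdelic (↥(maximalRealSubfield L)) (L : Type) (IsCMField.complexConj L) 3 (Matrix.diagonal (frameD V))) × UfThree S)
    (Φinf : 𝓢((Fin 3 → mixedSpace (↥(maximalRealSubfield L))), ℂ)) (Φf : FinSB (↥(maximalRealSubfield L)) (Fin 3)) :
    cmPairRep (L : Type) e₁ (frameD V) (frameD_real V) (frameD_ne V) (lineVec (L : Type) (dW' S 1)) (fun _ => dW'_real S 1) (fun _ => dW'_ne S 1)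
         hGR₃ (HodgeCM.WeilCoinv.finPairToAdelic _ _ _ _ _ _ _ p)
        (piSchwartzBruhatEquiv (↥(maximalRealSubfield L)) (Fin 3) (Φinf ⊗ₜ[ℂ] Φf)) =
      piSchwartzBruhatEquiv (↥(maximalRealSubfield L)) (Fin 3)
        (Φinf ⊗ₜ[ℂ] finSBReindex (↥(maximalRealSubfield L)) e₁
          (HodgeCM.WeilCoinv.finPairRep _ _ _ _ _ _ _ _ _ _ _ _ _ _ _ _ _
              (splittingOf_isCompatible _ _ _ _ _ _ _ _ _ _ _ _ _ _ _ _ _ hGR₃) p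
            ((finSBReindex (↥(maximalRealSubfield L)) e₁).symm Φf))) := by
  have key := HodgeCM.WeilCoinv.pairRep_finPairToAdelic_piSBReindex_tmul _ _ _ _ _ _ _ _ _ _ _ _ _ _ _ _ _
    (splittingOf_isCompatible _ _ _ _ _ _ _ _ _ _ _ _ _ _ _ _ _ hGR₃) p
    (schwartzReindexCLM (↥(maximalRealSubfield L)) e₁.symm Φinf) ((finSBReindex (↥(maximalRealSubfield L)) e₁).symm Φf)
  rw [piSBReindex_tmul, piSBReindex_tmul, schwartzReindexCLM_apply_symm_apply, LinearEquiv.apply_symm_apply] at key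
  exact key

omit hV in
/-- **the twisted line representation at a framed finite `U(V)`-element, on pure tensors**: `ω₁″((1,k_f),1) (Φ_∞ ⊗ Φ_f) = Φ_∞ ⊗ finRepThree (g,1) Φ_f`,
`k_f = finFrameCongr g` (tree Collapse + theta-3 #S14r2). -/
theorem cmConjLineRepFin₁_finPairThree_tmul (g : ↥V.adelicFin) (Φinf : 𝓢((Fin 3 → mixedSpace (↥(maximalRealSubfield L))), ℂ))
    (Φf : FinSB (↥(maximalRealSubfield L)) (Fin 3)) :
    cmConjLineRepFin₁ (L : Type) finProdFinEquiv e₁ (frameD V) (frameD_real V) (frameD_ne V) (dW S) (dW_real S) (dW_ne S) (dW' S) (dW'_real S)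
        (dW'_ne S) S.isoGL (isoGL_hg₀ S) hGR hGR₂ hGR₃ η₃
        (UnitaryGroup.finAdelicToAdelic (↥(maximalRealSubfield L)) (L : Type) (IsCMField.complexConj L) 3 (Matrix.diagonal (frameD V))
          (finFrameCongr (L : Type) V.Hm (frameG V) (frameD V) (frame_congr V) g), 1)
        (piSchwartzBruhatEquiv (↥(maximalRealSubfield L)) (Fin 3) (Φinf ⊗ₜ[ℂ] Φf)) =
      piSchwartzBruhatEquiv (↥(maximalRealSubfield L)) (Fin 3) (Φinf ⊗ₜ[ℂ] finRepThree V S hGR hGR₂ hGR₃ η₃ (g, 1) Φf) := by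
  rw [cmConjLineRepFin₁_apply_eq_smul_cmPairRep, map_one, map_one, finRepThree_apply, TensorProduct.tmul_smul, map_smul]
  congr 1
  · -- the scalars
    rw [finCharThree_apply, finPairDThree_apply, map_one, map_one]
    rfl
  · -- the operators
    have h := cmPairRep_finPairThree_tmul V S  hGR₃ (finFrameCongr (L : Type) V.Hm (frameG V) (frameD V) (frame_congr V) g, 1) Φinf Φf
    simp only [HodgeCM.WeilCoinv.finPairToAdelic_apply, map_one] at h
    exact h

/-- **`fin_V` for slot 3**: `lineRepOf … 1 (finToG V hV g, 1) = 1 ⊗ finRepThree (g, 1)` as operators on `𝒮(𝔸_{L⁺}³)`. -/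
theorem lineRepOf_three_finToG_eq_adelicTensorEnd (g : ↥V.adelicFin) :
    lineRepOf V S hGR hGR₀ hGR₁ hGR₂ hGR₃ η₀ η₁ η₂ η₃ 3 (finToG V hV g, 1) =
      adelicTensorEnd (K := ↥(maximalRealSubfield L)) (ι := Fin 3) LinearMap.id (finRepThree V S hGR hGR₂ hGR₃ η₃ (g, 1)) := by
  apply linearMap_ext_tensor
  intro Φinf Φf
  rw [adelicTensorEnd_apply_tmul, LinearMap.id_apply, finToG_apply, cmAdelicProdEquiv_symm_one,
    lineRepOf_three_regime_finAdelicG V S hGR hGR₀ hGR₁ hGR₂ hGR₃ η₀ η₁ η₂ η₃ hV g, cmConjLineRepFin₁_finPairThree_tmul]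

/-- **`fin_W` for slot 3**: `lineRepOf … 1 (1, finLineTorusIdeles u_f) = 1 ⊗ finRepThree (1, u_f)` as operators on `𝒮(𝔸_{L⁺}³)` (carch #CA60
`lineRepOf_three_one_finLineTorus` + theta-3 #S14r2 at the pair point `(1, u_f)`). -/
theorem lineRepOf_three_one_finLineTorusIdeles_eq_adelicTensorEnd (uf : UfThree S) :
    lineRepOf V S hGR hGR₀ hGR₁ hGR₂ hGR₃ η₀ η₁ η₂ η₃ 3 (1, finLineTorusIdeles (L : Type) (dW' S 1) (dW'_ne S 1) uf) =
      adelicTensorEnd (K := ↥(maximalRealSubfield L)) (ι := Fin 3) LinearMap.id (finRepThree V S hGR hGR₂ hGR₃ η₃ (1, uf)) := by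
  apply linearMap_ext_tensor
  intro Φinf Φf
  rw [adelicTensorEnd_apply_tmul, LinearMap.id_apply, lineRepOf_three_one_finLineTorus, finRepThree_apply, TensorProduct.tmul_smul, map_smul]
  congr 1
  · -- the scalars
    rw [torusScalar_three_applyG, finCharThree_apply, finPairDThree_apply, map_one, map_one, cmCenter_finLineTorus]
    rfl
  · -- the operators
    have h := cmPairRep_finPairThree_tmul V S  hGR₃ (1, uf) Φinf Φf
    simp only [HodgeCM.WeilCoinv.finPairToAdelic_apply, map_one] at h
    rw [map_one]
    exact h

/-! ### § 4. Smoothness of the finite factor of slot 3 -/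


-- port_pkg: scope closed for this part
end ThetaDistFin
end HodgeCM.Model
end
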